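import Literature.AnabelianGeometry.EtaleTheta.Discharge.Sec5Thm57Tower

/-!
# [EtTh] §5, Theorem 5.7 at ALL levels from the FIRST root: descent of the rigidity clause along the Remark 4.3.2 transitions (pp. 318–319, 330 / PDF pp. 92–93, 104)

Mochizuki, *The étale theta function …*, Publ. RIMS **45** (2009)
[cite: MochizukiEtTh2009, Thm 5.7 p.330 (PDF p.104); Rmk 4.3.2 p.318–319 (PDF pp.92–93)].  Seat abc-iut-L2-d4 (node
`EtTh:Thm5.7`; rows T2/T5/T6 of abc-iut-L2-t4's THM57-TOWER-PLAN.md); PROOF-ONLY over this seat's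
`Discharge/Sec5Thm57Tower.lean` (T2: `discrepancy_comp_beta_of_transports`; `thetaRootPreservedAll_of_rootOfUnity`)
and abc-iut-L2-t4's `FrobenioidThetaTower.lean`.

"By allowing `N` to vary, we obtain a compatible system of roots … hence a compatible system of Kummer classes"
(Rmk. 4.3.2, p.319 (PDF p.93)).  On abc-iut-L2-t4's tower the unit discrepancies `u_N := D_c⁻¹·D_p` of the root
transports form a COMPATIBLE SYSTEM `u_N ≫ β_{1,N} = β_{1,N} ≫ u_1` (T2, PROVED in `Sec5Thm57Tower.lean`) as soon as
the level-`N` identifications and divisor-matching automorphism DESCEND to level `1` compatibly with the transitions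
`α_{1,N}, β_{1,N}` ("`Ψ` maps the transition diagrams to transition diagrams" — the Cor. 5.12 setting, p.339 (PDF
p.113); Thm. 5.10 (i)).  Since "`β_{N,N'}` is an isometry of Frobenius degree `N'/N`" (p.319 (PDF p.93)), the
[FrdI] composition law raises the unit of `B_N` to the `N`-th power along `β_{1,N}`: `u_N^N = β_{1,N}^*(u_1)` in
`O^×(B_N^birat)`, compatibly with "the natural inclusion `K^× ↪ O^×(B_N^birat)`" (Lemma 5.8).  CONSEQUENCE (this file,
`ThetaFrobenioidTower.thetaRootPreservedAll_of_levelOne`): **Theorem 5.7's rigidity clause at EVERY level `N` follows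
from its instance at the FIRST root** — "the discrepancy of the transported right fraction-pair of `Θ̈^{1/l}` itself is
a `2l`-th root of unity of `K`" (`hζ₁`) — plus the two structural inputs just quoted (`hdesc`, `hconst`; binders,
D-0067 (1)).  The residual `hζ₁` is the honest heart of the printed proof ("the rigidity of the étale theta function
[cf. Corollary 2.8, (i)], [applied] to the Kummer classes of Proposition 5.2, (iii) … in light of … Proposition 5.5,
which, by Theorem 5.6, are preserved by `Ψ`", p.330 (PDF p.104)); its last step, Prop. 3.2 (iii) / Rmk. 4.3.2 ("a
compatible system of Kummer classes … is sufficient to distinguish `f`"), is recorded in the shape it will be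
consumed (`pow_eq_one_of_kummerTrivial`: Kummer-triviality of `c·ζ⁻¹` at all levels + no divisible constants ⇒
`c^{2l} = 1`).
HONEST FRAMING: kernel-checked implications between typed statements about the §5 data under named hypotheses;
nothing of [EtTh] is asserted unconditionally; typed ≠ discharged; no side taken on anything downstream. -/

namespace Literature.AnabelianGeometry.EtaleTheta

open CategoryTheory
open Literature.AlgebraicGeometry.Frobenioids

universe w v v' u u'

/-! ### T5 in consumable shape: Kummer-trivial at all levels + no divisible constants ⇒ `2l`-torsion -/

/-- **Prop. 3.2 (iii) / Rmk. 4.3.2, last step, as it will be consumed.**  If the constants have no non-trivial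
divisible element ("a compatible system of Kummer classes … is sufficient to distinguish `f` from other elements",
Rmk. 4.3.2 p.319 (PDF p.93); Prop. 3.2 (iii) p.296 (PDF p.70) — for `K` a finite extension of `ℚ_p`,
`⋂_N (K^×)^N = 1`) and the Kummer classes of `c` and of a `2l`-th root of unity `ζ` agree at every level (Hilbert 90
form: `c·ζ⁻¹` is an `N`-th power for every `N ≥ 1`), then `c^{2l} = 1`.
[cite: MochizukiEtTh2009, Rmk 4.3.2 p.319 (PDF p.93); Prop 3.2 (iii) p.296 (PDF p.70)] -/
theorem pow_eq_one_of_kummerTrivial {K : Type*} [CommGroup K] {l : ℕ}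
    (hK : ∀ x : K, (∀ N : ℕ+, ∃ d : K, d ^ (N : ℕ) = x) → x = 1) {c : K}
    (h : ∃ ζ : K, ζ ^ (2 * l) = 1 ∧ ∀ N : ℕ+, ∃ d : K, d ^ (N : ℕ) = c * ζ⁻¹) : c ^ (2 * l) = 1 := by
  obtain ⟨ζ, hζ, hN⟩ := h
  have hc : c * ζ⁻¹ = 1 := hK _ hN
  rw [mul_inv_eq_one] at hc
  rw [hc, hζ]

namespace ThetaFrobenioidTower

variable {C : Type u} [Category.{v} C] {D : Type u'} [Category.{v'} D] (𝔗 : ThetaFrobenioidTower.{w} C D)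
  (Ψ : C ≌ C)

/-- `1 ∣ N`: the first root lies under every level. [cite: MochizukiEtTh2009, Rmk 4.3.2 p.318 (PDF p.92)] -/
theorem one_dvd_level (N : ℕ+) : ((1 : ℕ+) : ℕ) ∣ (N : ℕ) := by
  rw [PNat.one_coe]; exact one_dvd _

/-- **Descent of the rigidity clause from level `1` to level `N`** (one transport datum).  Given the level-`N`
transport data `(α, β, e, D_c, D_p)` and level-`1` data `(α₁, β₁, e₁, D_c¹, D_p¹)` compatible with the transitions
`α_{1,N}, β_{1,N}` (`hΨα`, `hΨβ`, `he` — "`Ψ` maps the transition diagrams to transition diagrams", Cor. 5.12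
setting p.339 (PDF p.113)), T2 (`discrepancy_comp_beta_of_transports`) makes the discrepancies compatible,
`u_N ≫ β_{1,N} = β_{1,N} ≫ u_1`; the unit law along the Frobenius-degree-`N` isometry `β_{1,N}` (`hconst`: then
`u_N^N` is the constant `u_1` read in `O^×(B_N^birat)`) turns the LEVEL-1 rigidity "`u_1 = ζ ∈ μ_{2l}(K)`" (`hζ₁`)
into print's level-`N` clause `u_N^N = ζ`.  [cite: MochizukiEtTh2009, Rmk 4.3.2 p.318–319 (PDF pp.92–93); Thm 5.7 p.330 (PDF p.104)] -/
theorem hζ_of_descent (hepi : ∀ ⦃X Y : C⦄ (f : X ⟶ Y), Epi f) {N : ℕ+}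
    (hconst : ∀ (u : Aut (𝔗.BN N)) (hu : u ∈ (𝔗.atLevel N).units (𝔗.BN N)) (u₁ : Aut (𝔗.BN 1))
      (hu₁ : u₁ ∈ (𝔗.atLevel 1).units (𝔗.BN 1)) (c : 𝔗.Kˣ),
      u.hom ≫ 𝔗.β (one_dvd_level N) = 𝔗.β (one_dvd_level N) ≫ u₁.hom →
      (𝔗.atLevel 1).unitsToBirat (𝔗.BN 1) ⟨u₁, hu₁⟩ = 𝔗.constEmb 1 c →
        (𝔗.atLevel N).unitsToBirat (𝔗.BN N) ⟨u, hu⟩ ^ (N : ℕ) = 𝔗.constEmb N c)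
    {α : Ψ.functor.obj (𝔗.AN N) ≅ 𝔗.AN N} {β : Ψ.functor.obj (𝔗.BN N) ≅ 𝔗.BN N} {e : 𝔗.AN N ≅ 𝔗.AN N}
    {Dc Dp : Aut (𝔗.BN N)}
    (hT : α.inv ≫ Ψ.functor.map (𝔗.sCap N) ≫ β.hom = e.hom ≫ 𝔗.sCap N ≫ Dc.hom)
    (hT' : α.inv ≫ Ψ.functor.map (𝔗.sCup N) ≫ β.hom = e.hom ≫ 𝔗.sCup N ≫ Dp.hom)
    (hu : Dc⁻¹ * Dp ∈ (𝔗.atLevel N).units (𝔗.BN N))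
    {α₁ : Ψ.functor.obj (𝔗.AN 1) ≅ 𝔗.AN 1} {β₁ : Ψ.functor.obj (𝔗.BN 1) ≅ 𝔗.BN 1} {e₁ : 𝔗.AN 1 ≅ 𝔗.AN 1}
    {Dc₁ Dp₁ : Aut (𝔗.BN 1)}
    (hΨα : α.inv ≫ Ψ.functor.map (𝔗.α (one_dvd_level N)) ≫ α₁.hom = 𝔗.α (one_dvd_level N))
    (hΨβ : β.inv ≫ Ψ.functor.map (𝔗.β (one_dvd_level N)) ≫ β₁.hom = 𝔗.β (one_dvd_level N))
    (he : 𝔗.α (one_dvd_level N) ≫ e₁.hom = e.hom ≫ 𝔗.α (one_dvd_level N))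
    (hT₁ : α₁.inv ≫ Ψ.functor.map (𝔗.sCap 1) ≫ β₁.hom = e₁.hom ≫ 𝔗.sCap 1 ≫ Dc₁.hom)
    (hT₁' : α₁.inv ≫ Ψ.functor.map (𝔗.sCup 1) ≫ β₁.hom = e₁.hom ≫ 𝔗.sCup 1 ≫ Dp₁.hom)
    (hu₁ : Dc₁⁻¹ * Dp₁ ∈ (𝔗.atLevel 1).units (𝔗.BN 1))
    (hζ₁ : ∃ ζ : 𝔗.Kˣ, ζ ^ (2 * 𝔗.l) = 1 ∧ (𝔗.atLevel 1).unitsToBirat (𝔗.BN 1) ⟨Dc₁⁻¹ * Dp₁, hu₁⟩ = 𝔗.constEmb 1 ζ) :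
    ∃ ζ : 𝔗.Kˣ, ζ ^ (2 * 𝔗.l) = 1 ∧
      (𝔗.atLevel N).unitsToBirat (𝔗.BN N) ⟨Dc⁻¹ * Dp, hu⟩ ^ (N : ℕ) = 𝔗.constEmb N ζ := by
  obtain ⟨ζ, hζ, h1⟩ := hζ₁
  have hcomp := (𝔗.discrepancy_comp_beta_of_transports Ψ hepi (one_dvd_level N) α₁ α β₁ β hΨα hΨβ he
    hT₁ hT₁' hT hT').2.2
  exact ⟨ζ, hζ, hconst (Dc⁻¹ * Dp) hu (Dc₁⁻¹ * Dp₁) hu₁ ζ hcomp h1⟩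

/-- **[EtTh] Theorem 5.7 (root level) at ALL levels from its instance at the FIRST root.**  `ThetaRootPreservedAll Ψ`
from: the [FrdI] inputs of `Sec5Thm57.thetaRootPreserved_of` stated once over `𝔗.pre` (`C` totally epimorphic and of
isotropic type, Def. 1.3 (iii)(d), "`Ψ` preserves pre-steps" and base-equivalent pairs); Prop. 5.3 (vi) read at
every `A_N` (`hdiv`); the COMPATIBLE DESCENT of every level-`N` transport datum to level `1` (`hdesc`: identifications
`α₁, β₁` and a divisor-matching `e₁` compatible with `α_{1,N}, β_{1,N}` and with `e` — Rmk. 4.3.2 / Cor. 5.12 setting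
"`Ψ` maps the transition diagrams …", Thm. 5.10 (i), Prop. 5.3 (vi) at `A_1`); the unit law along the
Frobenius-degree-`N` isometry `β_{1,N}` compatible with the constants (`hconst`: Rmk. 4.3.2 p.319, [FrdI] Def. 1.1,
Lemma 5.8); and Theorem 5.7's rigidity clause AT LEVEL 1 in print's form (`hζ₁`: the discrepancy of the transported
right fraction-pair of `Θ̈^{1/l}` is a `2l`-th root of unity of `K` — Cor. 2.8 (i) via Prop. 5.2 (iii), Thm. 5.6).
The level-`N` clause then holds in BOTH halves (`mem_muTorsion_inf_OKxRootN_of_pow_eq_const`).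
[cite: MochizukiEtTh2009, Thm 5.7 p.329–330 (PDF pp.103–104); Rmk 4.3.2 p.318–319 (PDF pp.92–93)] -/
theorem thetaRootPreservedAll_of_levelOne (hepi : ∀ ⦃X Y : C⦄ (f : X ⟶ Y), Epi f)
    (hiso : 𝔗.pre.IsOfIsotropicType)
    (hiiid : ∀ ⦃A B B' : C⦄ (φ : A ⟶ B) (φ' : A ⟶ B'), 𝔗.pre.IsCoAngularPreStep φ →
      𝔗.pre.IsCoAngularPreStep φ' → 𝔗.pre.div φ ∣ 𝔗.pre.div φ' →
        ∃ f : B ⟶ B', 𝔗.pre.IsCoAngularPreStep f ∧ φ ≫ f = φ')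
    (hpre : PreFrobenioidData.PreservesMor Ψ.functor 𝔗.pre.IsPreStep 𝔗.pre.IsPreStep)
    (hbe : ∀ ⦃A B : C⦄ (φ ψ : A ⟶ B), 𝔗.pre.BaseEquivalent φ ψ →
      𝔗.pre.BaseEquivalent (Ψ.functor.map φ) (Ψ.functor.map ψ))
    (hdiv : ∀ (N : ℕ+) (α : Ψ.functor.obj (𝔗.AN N) ≅ 𝔗.AN N) (β : Ψ.functor.obj (𝔗.BN N) ≅ 𝔗.BN N),
      ∃ e : 𝔗.AN N ≅ 𝔗.AN N,
        𝔗.pre.div (α.inv ≫ Ψ.functor.map (𝔗.sCap N) ≫ β.hom) = 𝔗.pre.div (e.hom ≫ 𝔗.sCap N) ∧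
        𝔗.pre.div (α.inv ≫ Ψ.functor.map (𝔗.sCup N) ≫ β.hom) = 𝔗.pre.div (e.hom ≫ 𝔗.sCup N))
    (hdesc : ∀ (N : ℕ+) (α : Ψ.functor.obj (𝔗.AN N) ≅ 𝔗.AN N) (β : Ψ.functor.obj (𝔗.BN N) ≅ 𝔗.BN N)
      (e : 𝔗.AN N ≅ 𝔗.AN N) (Dc Dp : Aut (𝔗.BN N)),
      α.inv ≫ Ψ.functor.map (𝔗.sCap N) ≫ β.hom = e.hom ≫ 𝔗.sCap N ≫ Dc.hom →
      α.inv ≫ Ψ.functor.map (𝔗.sCup N) ≫ β.hom = e.hom ≫ 𝔗.sCup N ≫ Dp.hom →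
      ∃ (α₁ : Ψ.functor.obj (𝔗.AN 1) ≅ 𝔗.AN 1) (β₁ : Ψ.functor.obj (𝔗.BN 1) ≅ 𝔗.BN 1) (e₁ : 𝔗.AN 1 ≅ 𝔗.AN 1),
        α.inv ≫ Ψ.functor.map (𝔗.α (one_dvd_level N)) ≫ α₁.hom = 𝔗.α (one_dvd_level N) ∧
        β.inv ≫ Ψ.functor.map (𝔗.β (one_dvd_level N)) ≫ β₁.hom = 𝔗.β (one_dvd_level N) ∧
        𝔗.α (one_dvd_level N) ≫ e₁.hom = e.hom ≫ 𝔗.α (one_dvd_level N) ∧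
        𝔗.pre.div (α₁.inv ≫ Ψ.functor.map (𝔗.sCap 1) ≫ β₁.hom) = 𝔗.pre.div (e₁.hom ≫ 𝔗.sCap 1) ∧
        𝔗.pre.div (α₁.inv ≫ Ψ.functor.map (𝔗.sCup 1) ≫ β₁.hom) = 𝔗.pre.div (e₁.hom ≫ 𝔗.sCup 1))
    (hconst : ∀ (N : ℕ+) (u : Aut (𝔗.BN N)) (hu : u ∈ (𝔗.atLevel N).units (𝔗.BN N)) (u₁ : Aut (𝔗.BN 1))
      (hu₁ : u₁ ∈ (𝔗.atLevel 1).units (𝔗.BN 1)) (c : 𝔗.Kˣ),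
      u.hom ≫ 𝔗.β (one_dvd_level N) = 𝔗.β (one_dvd_level N) ≫ u₁.hom →
      (𝔗.atLevel 1).unitsToBirat (𝔗.BN 1) ⟨u₁, hu₁⟩ = 𝔗.constEmb 1 c →
        (𝔗.atLevel N).unitsToBirat (𝔗.BN N) ⟨u, hu⟩ ^ (N : ℕ) = 𝔗.constEmb N c)
    (hζ₁ : ∀ (α₁ : Ψ.functor.obj (𝔗.AN 1) ≅ 𝔗.AN 1) (β₁ : Ψ.functor.obj (𝔗.BN 1) ≅ 𝔗.BN 1)
      (e₁ : 𝔗.AN 1 ≅ 𝔗.AN 1) (Dc₁ Dp₁ : Aut (𝔗.BN 1)),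
      α₁.inv ≫ Ψ.functor.map (𝔗.sCap 1) ≫ β₁.hom = e₁.hom ≫ 𝔗.sCap 1 ≫ Dc₁.hom →
      α₁.inv ≫ Ψ.functor.map (𝔗.sCup 1) ≫ β₁.hom = e₁.hom ≫ 𝔗.sCup 1 ≫ Dp₁.hom →
      ∀ hu₁ : Dc₁⁻¹ * Dp₁ ∈ (𝔗.atLevel 1).units (𝔗.BN 1), ∃ ζ : 𝔗.Kˣ, ζ ^ (2 * 𝔗.l) = 1 ∧
        (𝔗.atLevel 1).unitsToBirat (𝔗.BN 1) ⟨Dc₁⁻¹ * Dp₁, hu₁⟩ = 𝔗.constEmb 1 ζ) :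
    𝔗.ThetaRootPreservedAll Ψ := by
  refine 𝔗.thetaRootPreservedAll_of_rootOfUnity Ψ hepi hiso hiiid hpre hbe hdiv fun N α β e Dc Dp hT hT' hu => ?_
  obtain ⟨α₁, β₁, e₁, hΨα, hΨβ, he, hd1, hd1'⟩ := hdesc N α β e Dc Dp hT hT'
  obtain ⟨Dc₁, Dp₁, hT₁, hT₁', hu₁⟩ := ThetaFrobenioid.exists_codTransport_of_div_eq (𝔉 := 𝔗.atLevel 1) Ψ α₁ β₁
    hepi hiso hiiid hpre hbe e₁ hd1 hd1'
  exact 𝔗.hζ_of_descent Ψ hepi (hconst N) hT hT' hu hΨα hΨβ he hT₁ hT₁' hu₁ (hζ₁ α₁ β₁ e₁ Dc₁ Dp₁ hT₁ hT₁' hu₁)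

end ThetaFrobenioidTower

end Literature.AnabelianGeometry.EtaleTheta
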